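import Literature.MathematicalPhysics.QuantumFieldTheory.ConformalBootstrap3D.DualFunctional
import Mathlib.Analysis.SpecialFunctions.OrdinaryHypergeometric
import Mathlib.Analysis.SpecialFunctions.Pow.Real
import Mathlib.Tactic.Linarith
import Mathlib.Tactic.FieldSimp
import Mathlib.Tactic.Ring
import HarnessLib

/-!
# The 2D Ising blind control, typed: what a certified 2D point-functional bound asserts
(cell `pub-ising3x`, seat controls-1; `SCOPE.md` §4(a) Stage B, round RB-0)

HONEST FRAMING: lottery ticket; floor = tightest certified 3D Ising CFT bounds; no exact-solution
claim without a proof.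

The cell's 2D BLIND CONTROL feeds CERTIFIED two-dimensional bootstrap intervals, unlabelled, to
the frozen recogniser. Its Stage B (RB-0, controls-1 gen 3, 2026-08-20) produced nine one-sided
bounds at `Δ_σ = 1/8` — `Δ_ε < 1.05, 1.02, 1.01, 1.005, 1.004` and `c > 0.496894`, `c > 0.493450` —
each from a rational point functional `φ = ∑_k w_k ev_{(z_k, z̄_k)}` checked by two independent
interval-arithmetic verifiers (`HOME/code/controls/rb0/verify_points2d.py` = verifier A,
`checkB_points2d.py` = verifier B; certificates and transcripts in
`HOME/pub-ising3x-controls-1/RB0/certs/`). This file TYPES the statement those certificates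
certify — the two-dimensional twin of
`Literature/…/ConformalBootstrap3D/SingleCorrelatorCertificate.lean` — and PROVES the elementary
implication "finitely many named obligations on `φ` ⇒ the bound". What it types:

* `chiralBlock h x = x^h ₂F₁(h, h; 2h; x)` and the parity-symmetrised global `sl(2,ℂ)` block
  `globalBlock Δ ℓ (z, z̄) = k_{2h}(z) k_{2h̄}(z̄) + k_{2h̄}(z) k_{2h}(z̄)`, `h = (Δ+ℓ)/2`,
  `h̄ = (Δ-ℓ)/2` — the `ε = 0` eigenfunctions of the Dolan–Osborn Casimir operator, in CLOSED FORM
  (Mathlib's `ordinaryHypergeometric`), so unlike `d = 3` no block-uniqueness obligation arises;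
* `CrossingData` + `IsUnitary` + `SatisfiesCrossing s` + `HasScalarGap U`: the data of a
  parity-symmetric solution of the `⟨σσσσ⟩` sum rule at external dimension `Δ_σ = s` with global
  conformal symmetry only (Virasoro NOT assumed): quasi-primaries of even spin `ℓ` and dimension
  `Δ ≥ ℓ` with squared OPE coefficients `p ≥ 0`, the pair `(h,h̄), (h̄,h)` entered ONCE with its
  common coefficient (this is where parity symmetry `⟨σσσσ⟩(z,z̄) = ⟨σσσσ⟩(z̄,z)` of the expansion
  is built in — automatic in `d ≥ 3`, an assumption in `d = 2`, true for the 2D Ising CFT), and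
  `∑_𝒪 p_𝒪 F_-[g_𝒪](z,z̄) = -F_-[1](z,z̄)` at every real point of the open square, `F_-[g] = crossF s (-1) g
  = v^s g(z,z̄) - u^s g(1-z,1-z̄)`;
* `GapExcluded s U`: no such datum has all its scalars at `Δ ≥ U` — i.e. "the lowest non-identity
  scalar of `σ×σ` has `Δ < U`" (`Δ_ε < U` for 2D Ising, where `Δ_σ = 1/8`, `Δ_ε = 1`);
  `OpeBound s gap P`: under a scalar gap `Δ ≥ gap`, every quasi-primary at `(Δ,ℓ) = (2,2)` has
  `p < P` — with the Virasoro Ward identity `p_T = Δ_σ²/(2c)` (a HYPOTHESIS here, not typed as a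
  fact) this is `c > Δ_σ²/(2P)` (`centralCharge_lower_bound`);
* `GapObligations φ s U E₀` / `OpeObligations φ s gap P E₀`: (I) identity positivity (resp. (I′)
  `φ[F_1] + P φ[F_T] > 0`, `φ[F_T] > 0`), block positivity on scalars `U ≤ Δ < E₀`, on even spins
  `0 < ℓ ≤ Δ < E₀`, and on everything with `Δ ≥ E₀` — exactly the split of verifier A
  ((C) = cells below `E₀`; (M)+(T) = the termwise argument above `E₀`, see
  `Control2DTermwise.lean`); `GapObligations.gapExcluded` / `OpeObligations.opeBound`: for an
  evaluation-continuous `φ` (every point functional with nodes in the square) the obligations imply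
  the bound (PROVED: crossing at the nodes + linearity + termwise signs);
* `CellPositive`, `scalar_nonneg_of_table`, `spinning_nonneg_of_table`: the below-`E₀` obligations
  from a finite table of `Δ`-cells per spin (PROVED, pure logic), the shape of a transcript.

What is NOT here: any value of a block, any inequality about a concrete `φ` (those are the
verifiers' interval computations; `Control2DCertificateRB0.lean` records the rational data and takes
the interval inequalities as explicit hypotheses), Virasoro symmetry, the Ward identity as a fact,
anything about the Ising model on `ℤ²`. Float context (not used): the 2D bound at `Δ_σ = 1/8` is
`Δ_ε ≤ 1.000003` with 60 derivative components (El-Showk–Paulos, PRL 111 (2013) 161602, via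
arXiv:1403.4545 §5.1); no certified 2D bound was located in print (SCOPE §4(a)).

Sources: F. A. Dolan, H. Osborn, Nucl. Phys. B 678 (2004) 491, §3 (variables `u = xz`,
`v = (1-x)(1-z)`; for `ε = 0` the eigenfunctions of `D_ε` are
`x^{λ₁} z^{λ₂} F(λ₁+a,λ₁+b;2λ₁+c;x) F(λ₂+a,λ₂+b;2λ₂+c;z) + (x ↔ z)`, `λ₁ = (Δ+ℓ)/2`,
`λ₂ = (Δ-ℓ)/2`, "applicable to two dimensional conformal field theories"; here `a = b = c = 0`);
R. Rattazzi, V. S. Rychkov, E. Tonni, A. Vichi, JHEP 12 (2008) 031, §3–§5 (sum rule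
`∑ p F = -F_𝟙`, `p ≥ 0`, linear functionals, trial-set truncation §5.5); A. A. Belavin,
A. M. Polyakov, A. B. Zamolodchikov, Nucl. Phys. B 241 (1984) 333 (Ward identity `⟨Tσσ⟩ ∝ h_σ`,
`⟨TT⟩ = c/2`). Tree: `crossF`, `pointFunctional`, `EvaluationContinuous`,
`evaluationContinuous_pointFunctional`, `exists_step_of_mem_Icc` from
`Literature/…/ConformalBootstrap3D/{SigmaEpsilonSystem,DualFunctional}.lean` (d-independent);
Mathlib: `ordinaryHypergeometric`, `Real.rpow`, `HasSum.nonneg`, `le_hasSum`.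
-/

namespace Summit.CriticalPhenomena.Ising3D.Control2D

open Set
open Literature.MathematicalPhysics.QuantumFieldTheory.ConformalBootstrap3D

/-! ### Two-dimensional global conformal blocks, in closed form -/

/-- The chiral `sl(2)` block `k_{2h}(x) = x^h ₂F₁(h, h; 2h; x)` (so `chiralBlock 0 = 1`,
`chiralBlock 2 x = k_4(x) = x² ₂F₁(2,2;4;x)`, the stress-tensor block). Dolan–Osborn 2004, §3,
`ε = 0`, `a = b = c = 0`. [cite: DolanOsborn2004, §3] -/
noncomputable def chiralBlock (h x : ℝ) : ℝ :=
  x ^ h * ordinaryHypergeometric h h (2 * h) x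

/-- The parity-symmetrised two-dimensional GLOBAL conformal block of a quasi-primary of dimension
`Δ` and spin `ℓ` exchanged between identical scalars:
`g_{Δ,ℓ}(z,z̄) = k_{2h}(z) k_{2h̄}(z̄) + k_{2h̄}(z) k_{2h}(z̄)`, `h = (Δ+ℓ)/2`, `h̄ = (Δ-ℓ)/2`
(for `ℓ = 0` this is `2 k_Δ(z) k_Δ(z̄)`; the factor is immaterial next to `p ≥ 0`). Dolan–Osborn 2004,
§3 (`ε = 0` eigenfunctions, `x ↔ z` symmetrised). [cite: DolanOsborn2004, §3] -/
noncomputable def globalBlock (Δ : ℝ) (ℓ : ℕ) (z zb : ℝ) : ℝ :=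
  chiralBlock ((Δ + ℓ) / 2) z * chiralBlock ((Δ - ℓ) / 2) zb +
    chiralBlock ((Δ - ℓ) / 2) z * chiralBlock ((Δ + ℓ) / 2) zb

/-- `₂F₁(0, 0; 0; x) = 1` (every coefficient beyond the constant one carries the factor `(0)_n = 0`).
[folklore] -/
theorem ordinaryHypergeometric_zero_params (x : ℝ) : ordinaryHypergeometric (0 : ℝ) 0 0 x = 1 := by
  rw [ordinaryHypergeometric, FormalMultilinearSeries.sum]
  have h1 : ∀ n : ℕ, n ≠ 0 →
      (ordinaryHypergeometricSeries ℝ (0 : ℝ) 0 0 n fun _ => x) = 0 := by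
    intro n hn
    rw [ordinaryHypergeometricSeries_eq_zero_of_neg_nat (𝔸 := ℝ) (a := (0 : ℝ)) (b := 0) (c := 0)
      (k := 0) (Or.inl (by simp)) (Nat.pos_of_ne_zero hn)]
    rfl
  rw [tsum_eq_single 0 h1, ordinaryHypergeometricSeries_apply_eq]
  simp

/-- `k_0 = 1`: the chiral block of weight `0` is the constant `1` (on `x ≠ 0`, and at `x = 0` by
Lean's `0 ^ 0 = 1`). [folklore] -/
theorem chiralBlock_zero (x : ℝ) : chiralBlock 0 x = 1 := by
  simp [chiralBlock, ordinaryHypergeometric_zero_params]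

/-! ### The data of a parity-symmetric solution to `⟨σσσσ⟩` crossing in `d = 2` -/

/-- The data the single-correlator 2D linear programme sees: an index type of the NON-IDENTITY
quasi-primaries exchanged in `σ×σ`, each with dimension `Δ`, spin `ℓ` (the pair `(h,h̄)`, `(h̄,h)`
entered once — parity-symmetric expansion) and squared OPE coefficient `p = λ²_{σσ𝒪}`. The identity
enters the sum rule explicitly (`p_𝟙 = 1`, block `1`). Rattazzi–Rychkov–Tonni–Vichi 2008, §3
eq. (3.5)–(3.6) (sum rule with `p ≥ 0`), read in `d = 2`. [cite: RattazziEtAl2008, §3] -/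
structure CrossingData where
  /-- Index type of the non-identity quasi-primaries of `σ×σ`. -/
  ι : Type
  /-- Scaling dimensions `Δ = h + h̄`. -/
  Δ : ι → ℝ
  /-- Spins `ℓ = |h - h̄|`. -/
  spin : ι → ℕ
  /-- Squared OPE coefficients `p = λ²_{σσ𝒪}` (common to `(h,h̄)` and `(h̄,h)`). -/
  p : ι → ℝ

namespace CrossingData

/-- **Unitarity with global conformal symmetry in `d = 2`**: `h, h̄ ≥ 0`, i.e. `Δ ≥ ℓ`; even spins
only in the OPE of two identical scalars (Bose symmetry); `p = λ² ≥ 0` (real OPE coefficients).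
[cite: RattazziEtAl2008, §3] -/
def IsUnitary (D : CrossingData) : Prop :=
  ∀ i, Even (D.spin i) ∧ (D.spin i : ℝ) ≤ D.Δ i ∧ 0 ≤ D.p i

/-- **Crossing (sum rule 1 of `⟨σσσσ⟩`) at external dimension `Δ_σ = s`**, as a `HasSum` identity at
every real point of the open square `z, z̄ ∈ (0,1)`:
`∑_𝒪 p_𝒪 F_-[g_𝒪](z,z̄) = -F_-[𝟙](z,z̄)`, `F_-[g] = v^s g(z,z̄) - u^s g(1-z,1-z̄)` (`crossF s (-1) g`).
Rattazzi–Rychkov–Tonni–Vichi 2008, eq. (3.5)–(3.6). [cite: RattazziEtAl2008, §3 eq. (3.6)] -/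
def SatisfiesCrossing (s : ℝ) (D : CrossingData) : Prop :=
  ∀ z zb : ℝ, z ∈ Ioo (0 : ℝ) 1 → zb ∈ Ioo (0 : ℝ) 1 →
    HasSum (fun i => D.p i * crossF s (-1) (globalBlock (D.Δ i) (D.spin i)) z zb)
      (-(crossF s (-1) (fun _ _ => (1 : ℝ)) z zb))

/-- The scalar-gap hypothesis of the gap-maximisation problem: every scalar (`ℓ = 0`) quasi-primary
of `σ×σ` other than the identity has `Δ ≥ U`. [cite: RattazziEtAl2008, §5] -/
def HasScalarGap (D : CrossingData) (U : ℝ) : Prop :=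
  ∀ i, D.spin i = 0 → U ≤ D.Δ i

/-- A smaller gap is implied by a larger one. Elementary. [folklore] -/
theorem HasScalarGap.mono {D : CrossingData} {U U' : ℝ} (h : D.HasScalarGap U') (hU : U ≤ U') :
    D.HasScalarGap U :=
  fun i hi => hU.trans (h i hi)

end CrossingData

/-- **The certified statement of an upper bound on the scalar gap.** `GapExcluded s U`: there is
no parity-symmetric unitary solution of the 2D `⟨σσσσ⟩` sum rule at `Δ_σ = s` (global blocks,
Virasoro not assumed) all of whose non-identity scalars have `Δ ≥ U`. For the 2D Ising CFT
(`Δ_σ = 1/8`) it reads `Δ_ε < U`. This is the class-2 (one-sided) item type of the cell's blind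
control. [cite: RattazziEtAl2008, §5] -/
def GapExcluded (s U : ℝ) : Prop :=
  ∀ D : CrossingData, D.IsUnitary → D.SatisfiesCrossing s → ¬ D.HasScalarGap U

/-- Monotonicity of the bound: excluding gap `U` excludes every larger gap. Elementary. [folklore] -/
theorem GapExcluded.mono {s U U' : ℝ} (h : GapExcluded s U) (hU : U ≤ U') : GapExcluded s U' :=
  fun D hu hc hgap => h D hu hc (hgap.mono hU)

/-- **The certified statement of an OPE-coefficient bound at the stress tensor.** `OpeBound s gap P`:
in every parity-symmetric unitary solution of the 2D `⟨σσσσ⟩` sum rule at `Δ_σ = s` whose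
non-identity scalars all have `Δ ≥ gap`, every quasi-primary at `(Δ, ℓ) = (2, 2)` — the block
`k_4(z) + k_4(z̄)` of `T ⊕ T̄` — has squared OPE coefficient `p < P`. With the Ward-identity value
`p_T = Δ_σ²/(2c)` this is the lower bound `c > Δ_σ²/(2P)` (`centralCharge_lower_bound`).
[cite: RattazziEtAl2008, §5] -/
def OpeBound (s gap P : ℝ) : Prop :=
  ∀ D : CrossingData, D.IsUnitary → D.SatisfiesCrossing s → D.HasScalarGap gap →
    ∀ i, D.Δ i = 2 → D.spin i = 2 → D.p i < P

/-- **From `p_T < P` to `c > Δ_σ²/(2P)`.** If the stress tensor's squared OPE coefficient in the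
normalisation `g_T = k_4(z) + k_4(z̄)` is the Ward-identity value `p_T = s²/(2c)` with `c > 0`
(Belavin–Polyakov–Zamolodchikov 1984: `⟨Tσσ⟩` fixed by `h_σ = s/2`, `⟨TT⟩ = c/2`, so
`p_T = 2h_σ²/c`) and `p_T < P`, then `c > s²/(2P)`. The Ward identity is a HYPOTHESIS of this lemma.
Elementary algebra. [cite: BelavinPolyakovZamolodchikov1984, §3] -/
theorem centralCharge_lower_bound {s c P pT : ℝ} (hc : 0 < c) (hWard : pT = s ^ 2 / (2 * c))
    (hlt : pT < P) : s ^ 2 / (2 * P) < c := by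
  have hP : 0 < P := by
    have : 0 ≤ pT := by rw [hWard]; positivity
    linarith
  rw [hWard, div_lt_iff₀ (by positivity)] at hlt
  rw [div_lt_iff₀ (by positivity)]
  linarith

/-! ### Obligations of a functional and the elementary soundness argument -/

/-- **Block positivity** of a linear functional `φ` at external dimension `s` on the block
`(Δ, ℓ)`: `φ[F_-[g_{Δ,ℓ}]] ≥ 0`. [cite: RattazziEtAl2008, §5 eq. (5.3)] -/
def BlockPositive (φ : (ℝ → ℝ → ℝ) →ₗ[ℝ] ℝ) (s Δ : ℝ) (ℓ : ℕ) : Prop :=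
  0 ≤ φ (crossF s (-1) (globalBlock Δ ℓ))

/-- **The obligations of a gap certificate** for a functional `φ`, external dimension `s`, scalar
gap `U` and the verifier's series threshold `E₀`: (I) `identity_pos`; block positivity on the
scalars `U ≤ Δ < E₀` (`scalar_nonneg`, verifier (C), spin-0 cells), on the even spins
`0 < ℓ ≤ Δ < E₀` (`spinning_nonneg`, verifier (C)), and on every unitary `(Δ, ℓ)` with `Δ ≥ E₀`
(`high_nonneg`, verifier (M)+(T) via the termwise argument). The trial-set truncation of
Rattazzi–Rychkov–Tonni–Vichi 2008, §5.5, in the shape of `verify_points2d/1.1`.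
[cite: RattazziEtAl2008, §5.5] -/
structure GapObligations (φ : (ℝ → ℝ → ℝ) →ₗ[ℝ] ℝ) (s U E₀ : ℝ) : Prop where
  /-- (I) `φ[F_-[𝟙]] > 0`. -/
  identity_pos : 0 < φ (crossF s (-1) (fun _ _ => (1 : ℝ)))
  /-- Scalars between the gap and the threshold. -/
  scalar_nonneg : ∀ Δ : ℝ, U ≤ Δ → Δ < E₀ → BlockPositive φ s Δ 0
  /-- Even non-zero spins below the threshold, `Δ ≥ ℓ` (2D unitarity). -/
  spinning_nonneg : ∀ ℓ : ℕ, Even ℓ → ℓ ≠ 0 → ∀ Δ : ℝ, (ℓ : ℝ) ≤ Δ → Δ < E₀ →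
    BlockPositive φ s Δ ℓ
  /-- Everything at or above the threshold (all even spins, `Δ ≥ ℓ`). -/
  high_nonneg : ∀ ℓ : ℕ, Even ℓ → ∀ Δ : ℝ, (ℓ : ℝ) ≤ Δ → E₀ ≤ Δ → BlockPositive φ s Δ ℓ

namespace GapObligations

variable {φ : (ℝ → ℝ → ℝ) →ₗ[ℝ] ℝ} {s U E₀ : ℝ}

/-- The three positivity clauses together cover every block allowed by 2D unitarity and the scalar
gap (case split on `Δ < E₀` and `ℓ = 0`). Elementary. [folklore] -/
theorem blockPositive (h : GapObligations φ s U E₀) (ℓ : ℕ) (hℓ : Even ℓ) (Δ : ℝ)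
    (hΔ : (ℓ : ℝ) ≤ Δ) (hgap : ℓ = 0 → U ≤ Δ) : BlockPositive φ s Δ ℓ := by
  rcases lt_or_ge Δ E₀ with hlt | hge
  · by_cases h0 : ℓ = 0
    · subst h0
      exact h.scalar_nonneg Δ (hgap rfl) hlt
    · exact h.spinning_nonneg ℓ hℓ h0 Δ hΔ hlt
  · exact h.high_nonneg ℓ hℓ Δ hΔ hge

/-- **Soundness of a gap certificate.** An evaluation-continuous functional (e.g. a point functional
with nodes in the open square) satisfying the obligations excludes the gap: apply `φ` termwise to
the sum rule at its nodes — every term `p_𝒪 φ[F_-[g_𝒪]]` is `≥ 0`, the total is `-φ[F_-[𝟙]] < 0`.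
Rattazzi–Rychkov–Tonni–Vichi 2008, §5 (the linear-functional argument). PROVED.
[cite: RattazziEtAl2008, §5] -/
theorem gapExcluded (hφ : EvaluationContinuous φ) (h : GapObligations φ s U E₀) :
    GapExcluded s U := by
  intro D hU hC hgap
  have hs := hφ.hasSum_mul D.p (fun i => crossF s (-1) (globalBlock (D.Δ i) (D.spin i)))
    (fun z zb => -(crossF s (-1) (fun _ _ => (1 : ℝ)) z zb)) (fun z zb hz hzb => hC z zb hz hzb)
  have hneg : φ (fun z zb => -(crossF s (-1) (fun _ _ => (1 : ℝ)) z zb))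
      = -(φ (crossF s (-1) (fun _ _ => (1 : ℝ)))) := by
    rw [← map_neg]; rfl
  rw [hneg] at hs
  have hnn : ∀ i, 0 ≤ D.p i * φ (crossF s (-1) (globalBlock (D.Δ i) (D.spin i))) := fun i =>
    mul_nonneg (hU i).2.2
      (h.blockPositive (D.spin i) (hU i).1 (D.Δ i) (hU i).2.1 (fun h0 => hgap i h0))
  have h0 : (0 : ℝ) ≤ -(φ (crossF s (-1) (fun _ _ => (1 : ℝ)))) := hs.nonneg hnn
  linarith [h.identity_pos]

end GapObligations

/-- **Gap certificate by a point functional.** A rational certificate instantiates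
`φ = ∑_k w_k ev_{(z_k, z̄_k)}` with nodes in the open square; then the obligations give
`GapExcluded s U`. PROVED. [cite: RattazziEtAl2008, §5] -/
theorem gapExcluded_of_points {n : ℕ} (w z zb : Fin n → ℝ) (hz : ∀ k, z k ∈ Ioo (0 : ℝ) 1)
    (hzb : ∀ k, zb k ∈ Ioo (0 : ℝ) 1) {s U E₀ : ℝ}
    (h : GapObligations (pointFunctional w z zb) s U E₀) : GapExcluded s U :=
  h.gapExcluded (evaluationContinuous_pointFunctional w z zb hz hzb)

/-- **The obligations of an OPE certificate** (`verify_points2d` kind `real-point-2d-ope`): (I′)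
`φ[F_-[𝟙]] + P·φ[F_-[g_T]] > 0` and `φ[F_-[g_T]] > 0` for the stress-tensor block `g_T = g_{2,2}`,
and block positivity on the scalars `gap ≤ Δ < E₀`, the even spins `0 < ℓ ≤ Δ < E₀`, and all
`Δ ≥ E₀`. [cite: RattazziEtAl2008, §5.5] -/
structure OpeObligations (φ : (ℝ → ℝ → ℝ) →ₗ[ℝ] ℝ) (s gap P E₀ : ℝ) : Prop where
  /-- (I′) `φ[F_-[𝟙]] + P φ[F_-[g_T]] > 0`. -/
  identity_ope : 0 < φ (crossF s (-1) (fun _ _ => (1 : ℝ))) + P * φ (crossF s (-1) (globalBlock 2 2))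
  /-- `φ[F_-[g_T]] > 0`. -/
  stress_pos : 0 < φ (crossF s (-1) (globalBlock 2 2))
  /-- Scalars between the gap and the threshold. -/
  scalar_nonneg : ∀ Δ : ℝ, gap ≤ Δ → Δ < E₀ → BlockPositive φ s Δ 0
  /-- Even non-zero spins below the threshold. -/
  spinning_nonneg : ∀ ℓ : ℕ, Even ℓ → ℓ ≠ 0 → ∀ Δ : ℝ, (ℓ : ℝ) ≤ Δ → Δ < E₀ →
    BlockPositive φ s Δ ℓ
  /-- Everything at or above the threshold. -/
  high_nonneg : ∀ ℓ : ℕ, Even ℓ → ∀ Δ : ℝ, (ℓ : ℝ) ≤ Δ → E₀ ≤ Δ → BlockPositive φ s Δ ℓ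

namespace OpeObligations

variable {φ : (ℝ → ℝ → ℝ) →ₗ[ℝ] ℝ} {s gap P E₀ : ℝ}

/-- The positivity clauses of an OPE certificate are those of a gap certificate with `U = gap`
(the identity clause follows from (I′) only together with `P ≥ 0`, which is not assumed; it is not
needed). Elementary. [folklore] -/
theorem blockPositive (h : OpeObligations φ s gap P E₀) (ℓ : ℕ) (hℓ : Even ℓ) (Δ : ℝ)
    (hΔ : (ℓ : ℝ) ≤ Δ) (hgap : ℓ = 0 → gap ≤ Δ) : BlockPositive φ s Δ ℓ := by
  rcases lt_or_ge Δ E₀ with hlt | hge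
  · by_cases h0 : ℓ = 0
    · subst h0
      exact h.scalar_nonneg Δ (hgap rfl) hlt
    · exact h.spinning_nonneg ℓ hℓ h0 Δ hΔ hlt
  · exact h.high_nonneg ℓ hℓ Δ hΔ hge

/-- **Soundness of an OPE certificate.** For an evaluation-continuous `φ` the obligations give
`OpeBound s gap P`: termwise, `p_T φ[F_T] ≤ ∑_𝒪 p_𝒪 φ[F_𝒪] = -φ[F_𝟙] < P φ[F_T]`. PROVED.
[cite: RattazziEtAl2008, §5] -/
theorem opeBound (hφ : EvaluationContinuous φ) (h : OpeObligations φ s gap P E₀) :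
    OpeBound s gap P := by
  intro D hU hC hgap i hΔ hspin
  have hs := hφ.hasSum_mul D.p (fun i => crossF s (-1) (globalBlock (D.Δ i) (D.spin i)))
    (fun z zb => -(crossF s (-1) (fun _ _ => (1 : ℝ)) z zb)) (fun z zb hz hzb => hC z zb hz hzb)
  have hneg : φ (fun z zb => -(crossF s (-1) (fun _ _ => (1 : ℝ)) z zb))
      = -(φ (crossF s (-1) (fun _ _ => (1 : ℝ)))) := by
    rw [← map_neg]; rfl
  rw [hneg] at hs
  have hnn : ∀ j, 0 ≤ D.p j * φ (crossF s (-1) (globalBlock (D.Δ j) (D.spin j))) := fun j =>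
    mul_nonneg (hU j).2.2
      (h.blockPositive (D.spin j) (hU j).1 (D.Δ j) (hU j).2.1 (fun h0 => hgap j h0))
  have hle : D.p i * φ (crossF s (-1) (globalBlock (D.Δ i) (D.spin i)))
      ≤ -(φ (crossF s (-1) (fun _ _ => (1 : ℝ)))) := le_hasSum hs i (fun j _ => hnn j)
  rw [hΔ, hspin] at hle
  have hT := h.stress_pos
  have hI := h.identity_ope
  by_contra hnot
  have hPle : P ≤ D.p i := not_lt.mp hnot
  have : P * φ (crossF s (-1) (globalBlock 2 2)) ≤
      D.p i * φ (crossF s (-1) (globalBlock 2 ((2 : ℕ)))) := by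
    exact mul_le_mul_of_nonneg_right hPle hT.le
  linarith

end OpeObligations

/-- **OPE certificate by a point functional.** PROVED. [cite: RattazziEtAl2008, §5] -/
theorem opeBound_of_points {n : ℕ} (w z zb : Fin n → ℝ) (hz : ∀ k, z k ∈ Ioo (0 : ℝ) 1)
    (hzb : ∀ k, zb k ∈ Ioo (0 : ℝ) 1) {s gap P E₀ : ℝ}
    (h : OpeObligations (pointFunctional w z zb) s gap P E₀) : OpeBound s gap P :=
  h.opeBound (evaluationContinuous_pointFunctional w z zb hz hzb)

/-! ### The finite cell table below the threshold (verifier obligation (C)) -/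

/-- **Cell positivity**: block positivity at spin `ℓ` uniformly for `Δ` in the closed cell `[a, b]`
— one `(C)` line of a verifier transcript (interval arithmetic on the cell, not at grid points).
[cite: RattazziEtAl2008, §5.5] -/
def CellPositive (φ : (ℝ → ℝ → ℝ) →ₗ[ℝ] ℝ) (s : ℝ) (ℓ : ℕ) (a b : ℝ) : Prop :=
  ∀ Δ ∈ Icc a b, BlockPositive φ s Δ ℓ

/-- The spin-0 obligation from a scalar cell table `t₀ ≤ U`, `t_K ≥ E₀` (`K ≥ 1` cells
`[t_k, t_{k+1}]`; monotonicity not needed). Elementary. [folklore] -/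
theorem scalar_nonneg_of_table {φ : (ℝ → ℝ → ℝ) →ₗ[ℝ] ℝ} {s U E₀ : ℝ} (t : ℕ → ℝ) {K : ℕ}
    (hK : 1 ≤ K) (h0 : t 0 ≤ U) (hK' : E₀ ≤ t K)
    (hcell : ∀ k < K, CellPositive φ s 0 (t k) (t (k + 1))) :
    ∀ Δ : ℝ, U ≤ Δ → Δ < E₀ → BlockPositive φ s Δ 0 := by
  intro Δ hU hlt
  obtain ⟨k, hk, hk1, hk2⟩ := exists_step_of_mem_Icc t hK (h0.trans hU) (hlt.le.trans hK')
  exact hcell k hk Δ ⟨hk1, hk2⟩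

/-- The spinning obligation from one cell row per even spin `0 < ℓ < L`, `E₀ ≤ L` (spins `ℓ ≥ E₀`
never occur below the threshold since `Δ ≥ ℓ`): row `ℓ` is `t_{ℓ,0} ≤ ℓ`, …, `t_{ℓ,K_ℓ} ≥ E₀`.
Elementary. [folklore] -/
theorem spinning_nonneg_of_table {φ : (ℝ → ℝ → ℝ) →ₗ[ℝ] ℝ} {s E₀ : ℝ} (L : ℕ) (hL : E₀ ≤ (L : ℝ))
    (t : ℕ → ℕ → ℝ) (K : ℕ → ℕ) (hK : ∀ ℓ < L, 1 ≤ K ℓ) (h0 : ∀ ℓ < L, t ℓ 0 ≤ (ℓ : ℝ))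
    (hK' : ∀ ℓ < L, E₀ ≤ t ℓ (K ℓ))
    (hcell : ∀ ℓ < L, Even ℓ → ℓ ≠ 0 → ∀ k < K ℓ, CellPositive φ s ℓ (t ℓ k) (t ℓ (k + 1))) :
    ∀ ℓ : ℕ, Even ℓ → ℓ ≠ 0 → ∀ Δ : ℝ, (ℓ : ℝ) ≤ Δ → Δ < E₀ → BlockPositive φ s Δ ℓ := by
  intro ℓ hℓ h0ℓ Δ hb hlt
  have hℓL : ℓ < L := by
    have h' : (ℓ : ℝ) < (L : ℝ) := lt_of_le_of_lt hb (lt_of_lt_of_le hlt hL)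
    exact_mod_cast h'
  obtain ⟨k, hk, hk1, hk2⟩ :=
    exists_step_of_mem_Icc (t ℓ) (hK ℓ hℓL) ((h0 ℓ hℓL).trans hb) (hlt.le.trans (hK' ℓ hℓL))
  exact hcell ℓ hℓL hℓ h0ℓ k hk Δ ⟨hk1, hk2⟩

/-- **Assembly of the gap obligations from a transcript-shaped table**: (I), the above-threshold
clause, a scalar cell row from `U` to `E₀`, and one cell row per even spin `0 < ℓ < L`, `E₀ ≤ L`.
Elementary. [cite: RattazziEtAl2008, §5.5] -/
theorem GapObligations.of_table {φ : (ℝ → ℝ → ℝ) →ₗ[ℝ] ℝ} {s U E₀ : ℝ} (L : ℕ)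
    (hL : E₀ ≤ (L : ℝ)) (hI : 0 < φ (crossF s (-1) (fun _ _ => (1 : ℝ))))
    (hhigh : ∀ ℓ : ℕ, Even ℓ → ∀ Δ : ℝ, (ℓ : ℝ) ≤ Δ → E₀ ≤ Δ → BlockPositive φ s Δ ℓ)
    (t₀ : ℕ → ℝ) {K₀ : ℕ} (hK₀ : 1 ≤ K₀) (ht₀ : t₀ 0 ≤ U) (ht₀' : E₀ ≤ t₀ K₀)
    (hcell₀ : ∀ k < K₀, CellPositive φ s 0 (t₀ k) (t₀ (k + 1)))
    (t : ℕ → ℕ → ℝ) (K : ℕ → ℕ) (hK : ∀ ℓ < L, 1 ≤ K ℓ) (ht : ∀ ℓ < L, t ℓ 0 ≤ (ℓ : ℝ))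
    (ht' : ∀ ℓ < L, E₀ ≤ t ℓ (K ℓ))
    (hcell : ∀ ℓ < L, Even ℓ → ℓ ≠ 0 → ∀ k < K ℓ, CellPositive φ s ℓ (t ℓ k) (t ℓ (k + 1))) :
    GapObligations φ s U E₀ where
  identity_pos := hI
  scalar_nonneg := scalar_nonneg_of_table t₀ hK₀ ht₀ ht₀' hcell₀
  spinning_nonneg := spinning_nonneg_of_table L hL t K hK ht ht' hcell
  high_nonneg := hhigh

end Summit.CriticalPhenomena.Ising3D.Control2D
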